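import Summits.CriticalPhenomena.PercolationContinuityZ3.Theorems.PercNearOneGluingNoHeavyPcintChainMem
import HarnessLib

/-!
# PCINT lane, reduction B3c (`chordchain_cw`) on the memory-`τ` DANGEROUS-SET automaton — per-step and per-word domination, glue

Cell `prim-pcint` (PAPER-2 track (iii): certified intervals for `p_c(ℤ^d)`), seat `prim-pcint-2` (gen 4); support file
(`--supports stmt-CriticalPhenomena-4575`).  Does NOT build on p205010.  Memo: `run/shared/lean/prim/pcint/REDUCTIONS.md` §B3c.

The full-information B3c weight (`…ChainBondUnits`) is a product of time factors
`cgapFactor s kc γ T = s^{dunitsAt kc γ T} · ((1+s²)/2)^{[T ≥ 2 ∧ IsCorner γ (T-2)]}` (`chainBondWeight_eq_prod`).  PROVED here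
(`cgapFactor_mul_le_bcwt`): along a self-avoiding word, at every time `t` the factor `cgapFactor s kc γ (t+1)` times `(s²)^{#on-path
events at t}` (the budget of at most two units per on-path event, booked on chords in the second part) is at most the automaton's
factor `s̄^{cdet} κ̄^{[bcorner]}` of `…ChainMem` read from the dangerous set of the prefix — using the unit comparison
`one_add_bcbonus_le_uF` for det-paying sites off the path, `card_bon_le` (`…ChordMem`) for sites on the path, and
`one_le_uF_cornerSite` for a claimed corner that is not genuine; constants `0 ≤ s ≤ s̄ ≤ 1`, `(1+s̄²)/2 ≤ κ̄`, `kc ≥ 2`, `kc + 4 ≤ τ`.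
Second part (per-word domination and the glue): for a self-avoiding word `γ` of length `n` the full B3c weight
`chainBondWeight p s kc γ` (`θ ≤ Σ chainBondWeight` in `…ChainBondReduction`) is at most the run weight of the dangerous-set B3c
automaton `bchainMemAut τ kc p ((1-p)·r²) s̄ κ̄` of `…ChainMem` from the empty state (`chainBondWeight_le_run`): the on-path budget is
paid by the refunds `r² ≥ 1/s²` of the detected chords and by the slack `(1-p) ≤ s⁴` of the undetected ones (each receives at most two
events: `card_onEventsR_le`; `p ≤ 1/2`).  Summing over `SAW_n` gives `Σ chainBondWeight ≤ total n ∅` and the glue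
**`le_criticalProb_zd_of_chainMem_total`**: a geometric bound `total n ∅ ≤ C λⁿ`, `λ < 1`, certifies `p ≤ p_c^bond(ℤ^d)`.
-/

noncomputable section

namespace Summit.CriticalPhenomena.PercolationContinuityZ3.Theorems.Pcint

open Finset Literature.Probability.Percolation Literature.Probability.LatticeModels ChainBond

variable {d : ℕ} (a₀ : Fin d × Bool) {τ kc n : ℕ} {γ : Fin n → Fin d × Bool}

/-! ### The time factors of the B3c weight -/

open Classical in
/-- The full B3c factor of a word at time `T`: `s^{dunitsAt T} · ((1+s²)/2)^{[T ≥ 2 ∧ corner at T-2]}`. [folklore] -/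
def cgapFactor (s : ℝ) (kc : ℕ) (γ : Fin n → Fin d × Bool) (T : ℕ) : ℝ :=
  s ^ dunitsAt kc γ T * (if 2 ≤ T ∧ IsCorner γ (T - 2) then (1 + s ^ 2) / 2 else 1)

/-- Time factors are nonnegative. [folklore] -/
theorem cgapFactor_nonneg {s : ℝ} (hs : 0 ≤ s) (kc : ℕ) (γ : Fin n → Fin d × Bool) (T : ℕ) : 0 ≤ cgapFactor s kc γ T := by
  unfold cgapFactor; split_ifs <;> positivity

/-- Time factors are at most one (`0 ≤ s ≤ 1`). [folklore] -/
theorem cgapFactor_le_one {s : ℝ} (hs : 0 ≤ s) (hs1 : s ≤ 1) (kc : ℕ) (γ : Fin n → Fin d × Bool) (T : ℕ) :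
    cgapFactor s kc γ T ≤ 1 := by
  unfold cgapFactor
  have h1 : s ^ dunitsAt kc γ T ≤ 1 := pow_le_one₀ hs hs1
  split_ifs
  · exact mul_le_one₀ h1 (by positivity) (by nlinarith)
  · rw [mul_one]; exact h1

/-- **The B3c weight as a product of time factors.** [folklore] -/
theorem chainBondWeight_eq_prod (p s : ℝ) (kc : ℕ) (γ : Fin n → Fin d × Bool) :
    chainBondWeight p s kc γ = p ^ n * (1 - p) ^ (chordEdges γ).card * ∏ T ∈ range (n + 1), cgapFactor s kc γ T := by
  classical
  unfold chainBondWeight cgapFactor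
  rw [prod_mul_distrib, prod_pow_eq_pow_sum, ← detTotal_eq_sum, prod_ite, prod_const_one, mul_one, prod_const,
    card_filter_corner, mul_assoc]

/-- No unit is paid at time `0`. [folklore] -/
theorem dunitsAt_zero (kc : ℕ) (γ : Fin n → Fin d × Bool) : dunitsAt kc γ 0 = 0 := by
  classical
  unfold dunitsAt
  refine sum_eq_zero fun w _ => ?_
  unfold uF
  have key : ∀ k, paysAt kc γ w k → incAt γ w k ≠ 0 := by
    intro k hp h0
    have := incAt_strictMono (by have := hp.1; omega : 0 < k) hp.2.1
    omega
  rw [Nat.add_eq_zero_iff, card_eq_zero, card_eq_zero, filter_eq_empty_iff, filter_eq_empty_iff]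
  exact ⟨fun k hk => key k (mem_paySet.1 hk), fun k hk => key k (mem_bonusSet.1 hk).1⟩

/-- The time-`0` factor is one. [folklore] -/
theorem cgapFactor_zero (s : ℝ) (kc : ℕ) (γ : Fin n → Fin d × Bool) : cgapFactor s kc γ 0 = 1 := by
  classical
  unfold cgapFactor
  rw [dunitsAt_zero, pow_zero, one_mul, if_neg (by omega)]

/-! ### Per-step domination -/

section Step

open Classical

/-- The automaton's units of a det-paying site: `1 + [bcbonus]`. [folklore] -/
def uA (τ kc : ℕ) (S : MState d) (w' : Site d) : ℕ := 1 + (if bcbonus τ kc S w' then 1 else 0)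

/-- `cdet` is the sum of the units of the det-paying sites. [folklore] -/
theorem cdet_eq_sum (τ kc : ℕ) (S : MState d) (a : Fin d × Bool) : cdet τ kc S a = ∑ w' ∈ cdetSet kc S a, uA τ kc S w' := by
  unfold cdet uA
  rw [sum_add_distrib, sum_const, smul_eq_mul, mul_one, card_filter]

/-- **Off-path units are full-information units**: the automaton's units at the det-paying sites off the path, plus one for a
claimed corner that is off the path but not genuine, are at most `dunitsAt kc γ (t+1)`. [folklore] -/
theorem sum_uA_off_le (hτ : kc + 4 ≤ τ) (hkc : 2 ≤ kc) {t : ℕ} (ht : t < n) (x : Bool)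
    (hx : x = true → bcorner (danger τ (pre a₀ γ t)) (γ ⟨t, ht⟩) = true ∧ cornerSite γ (t - 1) ∉ pathSites γ ∧ ¬ IsCorner γ (t - 1)) :
    (∑ w' ∈ (cdetSet kc (danger τ (pre a₀ γ t)) (γ ⟨t, ht⟩)).filter fun w' => w' + wordPos γ t ∉ pathSites γ,
        uA τ kc (danger τ (pre a₀ γ t)) w') + (if x then 1 else 0) ≤ dunitsAt kc γ (t + 1) := by
  set S := danger τ (pre a₀ γ t) with hS
  set Doff := (cdetSet kc S (γ ⟨t, ht⟩)).filter fun w' => w' + wordPos γ t ∉ pathSites γ with hDoff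
  set I := Doff.image fun w' => w' + wordPos γ t with hI
  -- the image lies in the off-path sites and every element is adjacent to `v_{t+1}`
  have hmemD : ∀ w' ∈ Doff, (zdGraph d).Adj (wordPos γ (t + 1)) (w' + wordPos γ t) ∧ w' + wordPos γ t ∉ pathSites γ := by
    intro w' hw'
    obtain ⟨hD, hoff⟩ := mem_filter.1 hw'
    have hn := (mem_filter.1 hD).1
    rw [mem_nbrSites] at hn
    refine ⟨?_, hoff⟩
    rw [← adj_sub_wordPos_iff γ t, ← stepVec_eq_sub ht, add_sub_cancel_right]; exact hn
  have hIsub : I ⊆ offSites γ := by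
    intro w hw
    obtain ⟨w', hw', rfl⟩ := mem_image.1 hw
    obtain ⟨hadj, hoff⟩ := hmemD w' hw'
    exact mem_offSites.2 ⟨hoff, t + 1, by omega, hadj⟩
  have hsumI : ∑ w' ∈ Doff, uA τ kc S w' ≤ ∑ w ∈ I, uF kc γ w (t + 1) := by
    rw [hI, sum_image fun x _ y _ h => add_right_cancel h]
    exact sum_le_sum fun w' hw' => one_add_bcbonus_le_uF a₀ hτ ht (mem_filter.1 hw').1
  cases x
  · simp only [Bool.false_eq_true, if_false, add_zero]
    exact hsumI.trans (sum_le_sum_of_subset hIsub)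
  · obtain ⟨hc, hcoff, hnc⟩ := hx rfl
    obtain ⟨huF, hnotD⟩ := one_le_uF_cornerSite a₀ hkc ht hc hcoff hnc
    simp only [if_true]
    have hCnot : cornerSite γ (t - 1) ∉ I := by
      intro hC
      obtain ⟨w', hw', hwC⟩ := mem_image.1 hC
      apply hnotD
      rw [show cornerSite γ (t - 1) - wordPos γ t = w' by rw [← hwC, add_sub_cancel_right]]
      exact (mem_filter.1 hw').1
    have hCoffS : cornerSite γ (t - 1) ∈ offSites γ := by
      obtain ⟨ht1, -, -, hC1, -⟩ := bcorner_spec a₀ ht hc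
      exact mem_offSites.2 ⟨hcoff, t + 1, by omega, hC1⟩
    calc ∑ w' ∈ Doff, uA τ kc S w' + 1 ≤ ∑ w ∈ I, uF kc γ w (t + 1) + uF kc γ (cornerSite γ (t - 1)) (t + 1) :=
          add_le_add hsumI huF
      _ = ∑ w ∈ insert (cornerSite γ (t - 1)) I, uF kc γ w (t + 1) := by rw [sum_insert hCnot, add_comm]
      _ ≤ dunitsAt kc γ (t + 1) := sum_le_sum_of_subset (insert_subset hCoffS hIsub)

/-- **On-path det-paying sites are on-path events** (and so is an on-path claimed corner). [folklore] -/
theorem card_cdet_on_le (hτ : 2 ≤ τ) {t : ℕ} (ht : t < n) (y : Bool)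
    (hy : y = true → bcorner (danger τ (pre a₀ γ t)) (γ ⟨t, ht⟩) = true ∧ cornerSite γ (t - 1) ∈ pathSites γ) :
    ((cdetSet kc (danger τ (pre a₀ γ t)) (γ ⟨t, ht⟩)).filter fun w' => w' + wordPos γ t ∈ pathSites γ).card + (if y then 1 else 0)
      ≤ ((onEventsR τ γ).filter fun th => th.1 = t).card := by
  have h1 := card_bon_le (γ := γ) a₀ hτ ht y hy
  have h2 : ((cdetSet kc (danger τ (pre a₀ γ t)) (γ ⟨t, ht⟩)).filter fun w' => w' + wordPos γ t ∈ pathSites γ).card ≤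
      ((bgapSet (danger τ (pre a₀ γ t)) (γ ⟨t, ht⟩)).filter fun w' => w' + wordPos γ t ∈ pathSites γ).card :=
    card_le_card (filter_subset_filter _ (cdetSet_subset_bgapSet kc _ _))
  omega

/-- Units of a site are at most two. [folklore] -/
theorem uA_le_two (τ kc : ℕ) (S : MState d) (w' : Site d) : uA τ kc S w' ≤ 2 := by
  unfold uA; split_ifs <;> omega

/-- **Per-step domination for kind `chordchain`** (B3c on dangerous sets). [folklore] -/
theorem cgapFactor_mul_le_bcwt (hτ : kc + 4 ≤ τ) (hkc : 2 ≤ kc) {t : ℕ} (ht : t < n)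
    {s sb κb : ℝ} (hs0 : 0 ≤ s) (hsb : s ≤ sb) (hsb1 : sb ≤ 1) (hκb : (1 + sb ^ 2) / 2 ≤ κb) :
    cgapFactor s kc γ (t + 1) * (s ^ 2) ^ ((onEventsR τ γ).filter fun th => th.1 = t).card ≤
      sb ^ cdet τ kc (danger τ (pre a₀ γ t)) (γ ⟨t, ht⟩) *
        (if bcorner (danger τ (pre a₀ γ t)) (γ ⟨t, ht⟩) then κb else 1) := by
  have hτ2 : 2 ≤ τ := by omega
  have hsb0 : 0 ≤ sb := hs0.trans hsb
  have hs1 : s ≤ 1 := hsb.trans hsb1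
  set S := danger τ (pre a₀ γ t) with hS
  set a := γ ⟨t, ht⟩ with ha
  set D := cdetSet kc S a with hD
  set Doff := D.filter fun w' => w' + wordPos γ t ∉ pathSites γ with hDoff
  set Don := D.filter fun w' => w' + wordPos γ t ∈ pathSites γ with hDon
  set e := ((onEventsR τ γ).filter fun th => th.1 = t).card with he
  set cornerF : ℝ := (if 2 ≤ t + 1 ∧ IsCorner γ (t + 1 - 2) then (1 + s ^ 2) / 2 else 1) with hcornerF
  have hsplit : cdet τ kc S a = ∑ w' ∈ Doff, uA τ kc S w' + ∑ w' ∈ Don, uA τ kc S w' := by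
    rw [cdet_eq_sum, hDoff, hDon, ← sum_filter_add_sum_filter_not D (fun w' => w' + wordPos γ t ∈ pathSites γ), add_comm]
  have hon2 : ∑ w' ∈ Don, uA τ kc S w' ≤ 2 * Don.card := by
    calc ∑ w' ∈ Don, uA τ kc S w' ≤ ∑ _w' ∈ Don, 2 := sum_le_sum fun w' _ => uA_le_two τ kc S w'
      _ = 2 * Don.card := by rw [sum_const, smul_eq_mul, mul_comm]
  have hcf0 : (0 : ℝ) ≤ cornerF := by rw [hcornerF]; split_ifs <;> positivity
  have hcf1 : cornerF ≤ 1 := by rw [hcornerF]; split_ifs <;> nlinarith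
  have hunfold : cgapFactor s kc γ (t + 1) = s ^ dunitsAt kc γ (t + 1) * cornerF := rfl
  -- the assembly, given the exponent comparison and the corner comparison
  have key : ∀ (X Y : ℕ) (K : ℝ), cdet τ kc S a + X + 2 * Y ≤ dunitsAt kc γ (t + 1) + 2 * e →
      s ^ X * s ^ (2 * Y) * cornerF ≤ K →
      cgapFactor s kc γ (t + 1) * (s ^ 2) ^ e ≤ sb ^ cdet τ kc S a * K := by
    intro X Y K hexp hK
    have hpow : s ^ dunitsAt kc γ (t + 1) * (s ^ 2) ^ e ≤ sb ^ cdet τ kc S a * (s ^ X * s ^ (2 * Y)) := by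
      calc s ^ dunitsAt kc γ (t + 1) * (s ^ 2) ^ e = s ^ (dunitsAt kc γ (t + 1) + 2 * e) := by rw [← pow_mul, ← pow_add]
        _ ≤ s ^ (cdet τ kc S a + X + 2 * Y) := pow_le_pow_of_le_one hs0 hs1 hexp
        _ = s ^ cdet τ kc S a * (s ^ X * s ^ (2 * Y)) := by rw [pow_add, pow_add, mul_assoc]
        _ ≤ sb ^ cdet τ kc S a * (s ^ X * s ^ (2 * Y)) :=
            mul_le_mul_of_nonneg_right (pow_le_pow_left₀ hs0 hsb _) (by positivity)
    rw [hunfold]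
    calc s ^ dunitsAt kc γ (t + 1) * cornerF * (s ^ 2) ^ e = (s ^ dunitsAt kc γ (t + 1) * (s ^ 2) ^ e) * cornerF := by ring
      _ ≤ (sb ^ cdet τ kc S a * (s ^ X * s ^ (2 * Y))) * cornerF := mul_le_mul_of_nonneg_right hpow hcf0
      _ = sb ^ cdet τ kc S a * (s ^ X * s ^ (2 * Y) * cornerF) := by ring
      _ ≤ sb ^ cdet τ kc S a * K := mul_le_mul_of_nonneg_left hK (pow_nonneg hsb0 _)
  have hss : s ^ 2 ≤ κb := by nlinarith
  have hs_le : s ≤ κb := by nlinarith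
  have hcoin : (1 + s ^ 2) / 2 ≤ κb := by nlinarith
  -- the plain bounds (no corner contribution)
  have hoff0 : ∑ w' ∈ Doff, uA τ kc S w' ≤ dunitsAt kc γ (t + 1) := by
    have := sum_uA_off_le (γ := γ) (kc := kc) a₀ hτ hkc ht false (fun h => Bool.noConfusion h); simpa using this
  have hon0 : Don.card ≤ e := by
    have := card_cdet_on_le (γ := γ) (kc := kc) a₀ hτ2 ht false (fun h => Bool.noConfusion h); simpa using this
  by_cases hc : bcorner S a = true
  · rw [if_pos hc]
    obtain ⟨ht1, -⟩ := bcorner_spec a₀ ht hc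
    by_cases hon' : cornerSite γ (t - 1) ∈ pathSites γ
    · -- corner site on the path: an extra on-path event pays `s²`
      have hon1 : Don.card + 1 ≤ e := by
        have := card_cdet_on_le (γ := γ) (kc := kc) a₀ hτ2 ht true (fun _ => ⟨hc, hon'⟩); simpa using this
      refine key 0 1 κb (by rw [hsplit]; omega) ?_
      have hnc : ¬ (2 ≤ t + 1 ∧ IsCorner γ (t + 1 - 2)) := by
        rintro ⟨-, hcor⟩
        rw [show t + 1 - 2 = t - 1 by omega] at hcor
        obtain ⟨_, _, hoffc, _⟩ := hcor
        exact hoffc hon'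
      rw [hcornerF, if_neg hnc]
      simpa using hss
    · by_cases hgc : IsCorner γ (t - 1)
      · -- a genuine corner: the coin
        refine key 0 0 κb (by rw [hsplit]; omega) ?_
        rw [hcornerF, if_pos ⟨by omega, by rw [show t + 1 - 2 = t - 1 by omega]; exact hgc⟩]
        simpa using hcoin
      · -- not a genuine corner: the corner site carries a full-information unit
        have hoff1 : ∑ w' ∈ Doff, uA τ kc S w' + 1 ≤ dunitsAt kc γ (t + 1) := by
          have := sum_uA_off_le (γ := γ) (kc := kc) a₀ hτ hkc ht true (fun _ => ⟨hc, hon', hgc⟩); simpa using this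
        refine key 1 0 κb (by rw [hsplit]; omega) ?_
        have hnc : ¬ (2 ≤ t + 1 ∧ IsCorner γ (t + 1 - 2)) := by
          rintro ⟨-, hcor⟩
          rw [show t + 1 - 2 = t - 1 by omega] at hcor
          exact hgc hcor
        rw [hcornerF, if_neg hnc]
        simpa using hs_le
  · rw [if_neg hc]
    refine key 0 0 1 (by rw [hsplit]; omega) ?_
    simpa using hcf1

end Step

/-! ### Per-word domination and the glue -/


include a₀ in
/-- **Per-word domination (B3c)**: for a self-avoiding word, the B3c weight is at most the run weight of
`bchainMemAut τ kc p ((1-p) r²) s̄ κ̄` from the empty dangerous set, whenever `0 < s ≤ s̄ ≤ 1`, `s² ≥ 1 - p²`, `p ≤ 1/2`,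
`(1+s̄²)/2 ≤ κ̄`, `r ≥ 0`, `s·r ≥ 1`, `(1-p)·r² ≤ 1`, `kc ≥ 2`, `kc + 4 ≤ τ`. [folklore] -/
theorem chainBondWeight_le_run (hτ : kc + 4 ≤ τ) (hkc : 2 ≤ kc) (hs : IsSAW γ) (p : unitInterval) {s sb κb r : ℝ}
    (hp : (p : ℝ) ≤ 1 / 2) (hs0 : 0 < s) (hsb : s ≤ sb) (hsb1 : sb ≤ 1) (hκb : (1 + sb ^ 2) / 2 ≤ κb)
    (hps : 1 - (p : ℝ) ^ 2 ≤ s ^ 2) (hr0 : 0 ≤ r) (hsr : 1 ≤ s * r) (hpr : (1 - (p : ℝ)) * (r * r) ≤ 1) :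
    chainBondWeight p s kc γ ≤
      (bchainMemAut τ kc p ((1 - p) * (r * r)) sb κb p.2.1 (mul_nonneg (sub_nonneg.2 p.2.2) (mul_nonneg hr0 hr0))
        (hs0.le.trans hsb) (by nlinarith)).run n ∅ γ := by
  classical
  have hp0 : (0 : ℝ) ≤ p := p.2.1
  have hp1 : (p : ℝ) ≤ 1 := p.2.2
  have hq0 : 0 ≤ 1 - (p : ℝ) := sub_nonneg.2 hp1
  have hsb0 : 0 ≤ sb := hs0.le.trans hsb
  have hs1 : s ≤ 1 := hsb.trans hsb1
  have hκb0 : 0 ≤ κb := by nlinarith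
  have hτ2 : 2 ≤ τ := by omega
  have hpr0 : 0 ≤ (1 - (p : ℝ)) * (r * r) := mul_nonneg hq0 (mul_nonneg hr0 hr0)
  -- `(1-p) ≤ s⁴` for `p ≤ 1/2`
  have hps' : 1 - (p : ℝ) ≤ s ^ 4 := by
    have h4 : (1 - (p : ℝ) ^ 2) ^ 2 ≤ (s ^ 2) ^ 2 := pow_le_pow_left₀ (by nlinarith) hps 2
    nlinarith
  set M := bchainMemAut (d := d) τ kc p ((1 - p) * (r * r)) sb κb hp0 hpr0 hsb0 hκb0 with hM
  -- the run follows the dangerous sets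
  have hrun := M.run_eq_prod_of_states n (fun t => danger τ (pre a₀ γ t)) γ (fun t ht => by
    rw [hM]; exact mstep_danger_pre a₀ hτ2 hs ht)
  rw [danger_zero τ _] at hrun
  rw [hrun, chainBondWeight_eq_prod, prod_range_succ' _ n, cgapFactor_zero, mul_one]
  have hwt : ∀ (t : ℕ) (ht : t < n), M.wt (danger τ (pre a₀ γ t)) (γ ⟨t, ht⟩) =
      (p : ℝ) * (((1 - p) * (r * r)) ^ bchord (danger τ (pre a₀ γ t)) (γ ⟨t, ht⟩) *
        (sb ^ cdet τ kc (danger τ (pre a₀ γ t)) (γ ⟨t, ht⟩) *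
          (if bcorner (danger τ (pre a₀ γ t)) (γ ⟨t, ht⟩) then κb else 1))) := fun t ht => by rw [hM]; rfl
  -- notation
  set CV := ∑ t ∈ range n, remChordTrue τ γ t with hCV
  set E := (onEventsR τ γ).card with hE
  have hCVeq : CV = (visChordsR τ γ).card := sum_remChordTrue_eq τ γ
  have hEle : E ≤ CV + 2 * (invChordsR τ γ).card := by rw [hCVeq]; exact card_onEventsR_le τ γ
  have hCH : CV + (invChordsR τ γ).card = (chordEdges γ).card := by
    rw [hCVeq, ← IsSAW.card_chordPairs_eq hs]; exact card_visChordsR_add_card_invChordsR τ γ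
  -- (1) chords and on-path events (two units per event)
  have hchords : (1 - (p : ℝ)) ^ (chordEdges γ).card * s ^ (2 * CV) ≤ (1 - (p : ℝ)) ^ CV * s ^ (2 * E) := by
    rw [← hCH, pow_add]
    calc (1 - (p : ℝ)) ^ CV * (1 - (p : ℝ)) ^ (invChordsR τ γ).card * s ^ (2 * CV)
        ≤ (1 - (p : ℝ)) ^ CV * (s ^ 4) ^ (invChordsR τ γ).card * s ^ (2 * CV) :=
          mul_le_mul_of_nonneg_right (mul_le_mul_of_nonneg_left (pow_le_pow_left₀ hq0 hps' _) (pow_nonneg hq0 _))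
            (pow_nonneg hs0.le _)
      _ = (1 - (p : ℝ)) ^ CV * s ^ (2 * (CV + 2 * (invChordsR τ γ).card)) := by rw [← pow_mul, mul_assoc, ← pow_add]; ring_nf
      _ ≤ (1 - (p : ℝ)) ^ CV * s ^ (2 * E) :=
          mul_le_mul_of_nonneg_left (pow_le_pow_of_le_one hs0.le hs1 (by omega)) (pow_nonneg hq0 _)
  -- (2) gap/corner factors and on-path events, step by step
  have hE_fib : E = ∑ t ∈ range n, ((onEventsR τ γ).filter fun th => th.1 = t).card := by
    rw [hE]
    exact card_eq_sum_card_fiberwise fun th hth => by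
      rw [mem_coe, mem_range]; exact (mem_onEventsR.1 hth).1
  have hsteps : (∏ t ∈ range n, cgapFactor s kc γ (t + 1)) * s ^ (2 * E) ≤
      ∏ t ∈ range n, (if ht : t < n then (sb ^ cdet τ kc (danger τ (pre a₀ γ t)) (γ ⟨t, ht⟩) *
        (if bcorner (danger τ (pre a₀ γ t)) (γ ⟨t, ht⟩) then κb else 1)) else 1) := by
    rw [pow_mul, hE_fib, ← prod_pow_eq_pow_sum, ← prod_mul_distrib]
    refine prod_le_prod (fun t _ => mul_nonneg (cgapFactor_nonneg hs0.le kc γ _) (pow_nonneg (sq_nonneg s) _))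
      fun t ht => ?_
    have ht' := mem_range.1 ht
    rw [dif_pos ht']
    exact cgapFactor_mul_le_bcwt a₀ hτ hkc ht' hs0.le hsb hsb1 hκb
  -- (3) the refunds of the detected chords
  set A := ∏ t ∈ range n, (if ht : t < n then ((1 - (p : ℝ)) * (r * r)) ^ bchord (danger τ (pre a₀ γ t)) (γ ⟨t, ht⟩)
    else 1) with hA
  set B := ∏ t ∈ range n, (if ht : t < n then (sb ^ cdet τ kc (danger τ (pre a₀ γ t)) (γ ⟨t, ht⟩) *
    (if bcorner (danger τ (pre a₀ γ t)) (γ ⟨t, ht⟩) then κb else 1)) else 1) with hB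
  have hA0 : 0 ≤ A := prod_nonneg fun t _ => by split_ifs <;> positivity
  have hrefund : (1 - (p : ℝ)) ^ CV ≤ A * s ^ (2 * CV) := by
    have h1 : (∏ t ∈ range n, ((1 - (p : ℝ)) * (r * r)) ^ remChordTrue τ γ t) ≤ A := by
      refine prod_le_prod (fun t _ => pow_nonneg hpr0 _) fun t ht => ?_
      rw [dif_pos (mem_range.1 ht)]
      exact pow_le_pow_of_le_one hpr0 hpr (bchord_le_remChordTrue a₀ (mem_range.1 ht))
    have h2 : (∏ t ∈ range n, ((1 - (p : ℝ)) * (r * r)) ^ remChordTrue τ γ t) * s ^ (2 * CV) =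
        (1 - (p : ℝ)) ^ CV * ((r * s) * (r * s)) ^ CV := by
      rw [prod_pow_eq_pow_sum, ← hCV, pow_mul, ← mul_pow, ← mul_pow]; ring
    have h3 : (1 : ℝ) ≤ ((r * s) * (r * s)) ^ CV :=
      one_le_pow₀ (one_le_mul_of_one_le_of_one_le (by rw [mul_comm]; exact hsr) (by rw [mul_comm]; exact hsr))
    calc (1 - (p : ℝ)) ^ CV ≤ (1 - (p : ℝ)) ^ CV * ((r * s) * (r * s)) ^ CV := le_mul_of_one_le_right (pow_nonneg hq0 _) h3
      _ = _ := h2.symm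
      _ ≤ A * s ^ (2 * CV) := mul_le_mul_of_nonneg_right h1 (pow_nonneg hs0.le _)
  -- the product of the automaton weights, split
  have hprod : (∏ t ∈ range n, if ht : t < n then M.wt (danger τ (pre a₀ γ t)) (γ ⟨t, ht⟩) else 1) =
      (p : ℝ) ^ n * (A * B) := by
    have hpn : (p : ℝ) ^ n = ∏ _t ∈ range n, (p : ℝ) := by rw [prod_const, card_range]
    rw [hpn, hA, hB, ← prod_mul_distrib, ← prod_mul_distrib]
    refine prod_congr rfl fun t ht => ?_
    have ht' := mem_range.1 ht
    rw [dif_pos ht', dif_pos ht', dif_pos ht', hwt t ht']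
  set Pk := ∏ t ∈ range n, cgapFactor s kc γ (t + 1) with hPkdef
  have hPk : 0 ≤ Pk := prod_nonneg fun T _ => cgapFactor_nonneg hs0.le kc γ _
  have hsCV : 0 < s ^ (2 * CV) := pow_pos hs0 _
  have hkey : (1 - (p : ℝ)) ^ (chordEdges γ).card * Pk ≤ A * B := by
    have h1 : (1 - (p : ℝ)) ^ (chordEdges γ).card * Pk * s ^ (2 * CV) ≤ A * B * s ^ (2 * CV) := by
      calc (1 - (p : ℝ)) ^ (chordEdges γ).card * Pk * s ^ (2 * CV)
          = ((1 - (p : ℝ)) ^ (chordEdges γ).card * s ^ (2 * CV)) * Pk := by ring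
        _ ≤ ((1 - (p : ℝ)) ^ CV * s ^ (2 * E)) * Pk := mul_le_mul_of_nonneg_right hchords hPk
        _ = (1 - (p : ℝ)) ^ CV * (Pk * s ^ (2 * E)) := by ring
        _ ≤ (A * s ^ (2 * CV)) * B := mul_le_mul hrefund hsteps (mul_nonneg hPk (pow_nonneg hs0.le _))
            (mul_nonneg hA0 (pow_nonneg hs0.le _))
        _ = A * B * s ^ (2 * CV) := by ring
    exact le_of_mul_le_mul_right h1 hsCV
  rw [hprod]
  calc (p : ℝ) ^ n * (1 - (p : ℝ)) ^ (chordEdges γ).card * Pk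
      = (p : ℝ) ^ n * ((1 - (p : ℝ)) ^ (chordEdges γ).card * Pk) := by ring
    _ ≤ (p : ℝ) ^ n * (A * B) := mul_le_mul_of_nonneg_left hkey (pow_nonneg hp0 _)

include a₀ in
/-- **Sum form**: `Σ_{γ ∈ SAW_n} chainBondWeight p s kc γ ≤ total n ∅` for the dangerous-set B3c automaton. [folklore] -/
theorem sum_chainBondWeight_le_total (hτ : kc + 4 ≤ τ) (hkc : 2 ≤ kc) (p : unitInterval) {s sb κb r : ℝ}
    (hp : (p : ℝ) ≤ 1 / 2) (hs0 : 0 < s) (hsb : s ≤ sb) (hsb1 : sb ≤ 1) (hκb : (1 + sb ^ 2) / 2 ≤ κb)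
    (hps : 1 - (p : ℝ) ^ 2 ≤ s ^ 2) (hr0 : 0 ≤ r) (hsr : 1 ≤ s * r) (hpr : (1 - (p : ℝ)) * (r * r) ≤ 1) (n : ℕ) :
    ∑ γ ∈ sawWords d n, chainBondWeight p s kc γ ≤
      (bchainMemAut τ kc p ((1 - p) * (r * r)) sb κb p.2.1 (mul_nonneg (sub_nonneg.2 p.2.2) (mul_nonneg hr0 hr0))
        (hs0.le.trans hsb) (by nlinarith)).total n (∅ : MState d) := by
  classical
  set M := bchainMemAut (d := d) τ kc p ((1 - p) * (r * r)) sb κb p.2.1 (mul_nonneg (sub_nonneg.2 p.2.2) (mul_nonneg hr0 hr0))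
    (hs0.le.trans hsb) (by nlinarith) with hM
  calc ∑ γ ∈ sawWords d n, chainBondWeight p s kc γ ≤ ∑ γ ∈ sawWords d n, M.run n ∅ γ :=
        sum_le_sum fun γ hγ => by
          rw [hM]; exact chainBondWeight_le_run a₀ hτ hkc (mem_sawWords.1 hγ) p hp hs0 hsb hsb1 hκb hps hr0 hsr hpr
    _ ≤ M.total n ∅ := M.sum_run_le_total n ∅ _

/-! ### The glue: a geometric bound on the totals gives a lower bound on `p_c^bond(ℤ^d)` -/

/-- **Reduced-state B3c certificate ⇒ `p ≤ p_c^bond(ℤ^d)`.**  If the totals of the dangerous-set B3c automaton from the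
empty state are geometrically small, `total n ∅ ≤ C λⁿ` with `λ < 1`, for constants `p ≤ 1/2`, `0 < s ≤ s̄ ≤ 1`, `s² ≥ 1 - p²`,
`(1+s̄²)/2 ≤ κ̄`, `r ≥ 0`, `s·r ≥ 1`, `(1-p)·r² ≤ 1`, `kc ≥ 2`, `kc + 4 ≤ τ`, then `p ≤ p_c^bond(ℤ^d)`. [folklore] -/
theorem le_criticalProb_zd_of_chainMem_total [NeZero d] {τ kc : ℕ} (hτ : kc + 4 ≤ τ) (hkc : 2 ≤ kc) (p : unitInterval)
    {s sb κb r C lam : ℝ} (hp : (p : ℝ) ≤ 1 / 2) (hs0 : 0 < s) (hsb : s ≤ sb) (hsb1 : sb ≤ 1)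
    (hκb : (1 + sb ^ 2) / 2 ≤ κb) (hps : 1 - (p : ℝ) ^ 2 ≤ s ^ 2) (hr0 : 0 ≤ r) (hsr : 1 ≤ s * r)
    (hpr : (1 - (p : ℝ)) * (r * r) ≤ 1) (hlam0 : 0 ≤ lam) (hlam1 : lam < 1)
    (htot : ∀ n, (bchainMemAut τ kc p ((1 - p) * (r * r)) sb κb p.2.1 (mul_nonneg (sub_nonneg.2 p.2.2) (mul_nonneg hr0 hr0))
      (hs0.le.trans hsb) (by nlinarith)).total n (∅ : MState d) ≤ C * lam ^ n) :
    (p : ℝ) ≤ criticalProb (zdGraph d) 0 :=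
  le_criticalProb_zd_of_chainBond_le_geometric d p hp hs0.le (hsb.trans hsb1) hps hkc hlam0 hlam1 (C := C) fun n =>
    (sum_chainBondWeight_le_total ((⟨0, NeZero.pos d⟩, true) : Fin d × Bool) hτ hkc p hp hs0 hsb hsb1 hκb hps hr0 hsr hpr
      n).trans (htot n)


end Summit.CriticalPhenomena.PercolationContinuityZ3.Theorems.Pcint
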